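/-
Copyright (c) 2026. All rights reserved.
Released under Apache 2.0 license as described in the file LICENSE.
-/
import Literature.NumberTheory.ComplexMultiplication.DegenerateCMTypesAbelianSwaps
import Literature.NumberTheory.ComplexMultiplication.DegenerateCMTypesElementaryAbelianOrderThirtyTwo
import Mathlib.Data.Nat.Choose.Sum
import HarnessLib

/-!
# The distribution of the sign counts `a_χ(T)` over the CM types of an elementary abelian `2`-group: `C(|G|/2, j)`
# types with `a_χ(T) = j`, `2^{|G|/2 − 1}` even and `2^{|G|/2 − 1}` odd types, and the MOMENTS
# `Σ_T (|T| − 2a_χ(T))^k = Σ_j C(|G|/2, j)(|G|/2 − 2j)^k` of the character sums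

SETTING (tree `CMTypeRankCharacters`, `DegenerateCMTypesElementaryAbelianTwoGroup`, `DegenerateCMTypesAbelianSwaps`;
T. Kubota [Kubota1965] §4 Lemma 2 = B. B. Gordon [Gordon1999HodgeAVSurvey] Prop. 9.4.1; B. Dodson [Dodson1984] §3.1.1).
`G` a finite commutative group of exponent `2`, `ρ ∈ G`, `χ` an ODD character (`χ(ρ) = −1`), `T ⊆ G` a CM type
(`IsCMTypeWith ρ T`), `a_χ(T) = #{t ∈ T : χ(t) = −1}` its sign count along `χ`, so that `Ŝ_T(χ) = Σ_{t∈T} χ(t) =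
|T| − 2a_χ(T)` (tree `sum_char_eq_card_sub_two_mul`), and `R_χ = {g : χ(g) = 1}` the KERNEL TYPE of `χ` (a CM type of
rank `2`, tree `isCMTypeWith_filter_eq_one`).  Dodson's dictionary [Dodson1984] §3.1.1: relative to the imaginary
quadratic subfield `K^{ker χ}` a CM type of a multiquadratic field IS a vector `f ∈ (ℤ₂)^{|G|/2}`, i.e. a subset
`D ⊆ R_χ`; in the tree's swap language (`DegenerateCMTypesAbelianSwaps`) `T = R_χ^D = (R_χ ∖ D) ∪ ρD` with
`D = R_χ ∖ T`, and `a_χ(T) = |D|`.  THIS FILE turns the dictionary into counts: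

> **Theorem** (`sum_eq_sum_powerset`, the swap parametrisation).  `T ↦ R_χ ∖ T` is a bijection from the CM types
> onto the subsets of `R_χ`, with inverse `D ↦ R_χ^D` and `a_χ(T) = |R_χ ∖ T|`; hence for every `f`,
> `Σ_{T CM type} f(a_χ(T)) = Σ_{D ⊆ R_χ} f(|D|) = Σ_{j=0}^{m} C(m, j)·f(j)`, `m = |G|/2` (`sum_eq_sum_range_choose`).
> **Corollaries.**  `#{T : a_χ(T) = j} = C(|G|/2, j)` (`card_filter_signCount_eq`); **`#{T : a_χ(T) even} =
> #{T : a_χ(T) odd} = 2^{|G|/2 − 1}`** (`card_filter_even_signCount`, `card_filter_odd_signCount`) — with the tree's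
> parity class (`card_filter_mod_two_eq`, `8 ∣ |G|`: the parity does not depend on `χ`) and `typeRank_eq_of_odd`
> (odd ⟹ nondegenerate): **at least half of the CM types of a multiquadratic CM field of degree `≥ 8` are
> nondegenerate** (`two_pow_le_card_filter_typeRank_eq`); ORDER `16`: nondegenerate ⟺ odd
> (`typeRank_eq_nine_iff_odd_of_card_sixteen`), so the `128` odd types are the nondegenerate ones; ORDER `32`:
> `32768` odd types, all of rank `17` (`card_filter_odd_signCount_of_card_eq_thirtyTwo`).
> **Moments** (`sum_pow_signCount_eq`).  `Σ_T (m − 2a_χ(T))^k = Σ_j C(m, j)(m − 2j)^k` and the same over the even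
> types with `j` even; numerically (`…_of_card_eq_sixteen / thirtyTwo`): order `16`: `Σ_{T even} (4 − a_χ(T))⁴ = 1408`;
> ORDER `32`: **`Σ_{T even} (8 − a_χ(T))⁴ = 1507328`** for every odd `χ` — the input of the fourth-moment count of
> the rank-`11` and rank-`17` types in the sequel.

(In Boolean terms: for `f : 𝔽₂ⁿ → 𝔽₂` and the character `χ ↔ a ∈ 𝔽₂ⁿ`, `a_χ(T)` is the weight of `f + a·x` and
`m − 2a_χ(T) = W_f(a)` the Walsh coefficient; `Σ_f W_f(a)⁴` over ALL `f` is the fourth moment of a sum of `2ⁿ`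
independent signs, C. Carlet [Carlet2020] §3.1 (3.10) for the fourth moment of one `f`.)

* §0 helpers.
* §1 the parametrisation: `sdiff_sdiff_union_image_eq` (`R_χ ∖ R_χ^D = D`), `sdiff_union_image_kernel_sdiff_eq`
  (`R_χ^{R_χ ∖ T} = T`), `card_filter_eq_card_kernel_sdiff` (`a_χ(T) = |R_χ ∖ T|`), **`sum_eq_sum_powerset`**,
  **`sum_eq_sum_range_choose`**.
* §2 counts: **`card_filter_signCount_eq`** (`C(|G|/2, j)`), **`card_filter_even_signCount`**,
  **`card_filter_odd_signCount`** (`2^{|G|/2 − 1}` each; half the subsets of a non-empty finset are even),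
  `two_pow_le_card_filter_typeRank_eq` (`8 ∣ |G|`, `ρ ≠ 1`), `typeRank_eq_nine_iff_odd_of_card_sixteen`,
  `card_filter_odd_signCount_of_card_eq_sixteen` (`128` = the rank-`9` types), `card_filter_odd_signCount_of_card_eq_thirtyTwo`
  (`32768` odd, `32768` even), `filter_odd_subset_filter_typeRank_eq_of_card_eq_thirtyTwo` (odd ⟹ rank `17`),
  `even_of_typeRank_ne_of_card_eq_thirtyTwo`.
* §3 moments: **`sum_pow_signCount_eq`**, `sum_filter_even_eq`, `sum_filter_even_fourth_of_card_eq_sixteen` (`1408`),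
  **`sum_filter_even_fourth_of_card_eq_thirtyTwo`** (`1507328`), `sum_fourth_of_card_eq_thirtyTwo` (`3014656`).

HONEST SCOPE.  Elementary regrouping; the sources print the weight dictionary (Dodson), Kubota's formula and the
Walsh calculus (Carlet); the binomial bookkeeping and the numbers are this file's.  THEOREMS ONLY: no definition, no
named fact, no instance, no `sorry`.

## References

* [Dodson1984] B. Dodson, *The structure of Galois groups of CM-fields*, Trans. AMS 283 (1984), §3.1.1 Theorem
  (types of a field of type `(2, …, 2)` as vectors `f ∈ (ℤ₂)ⁿ`), §3.2.1.
* [Kubota1965] T. Kubota, *On the field extension by complex multiplication*, Trans. AMS 118 (1965), §4 Lemma 2.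
* [Gordon1999HodgeAVSurvey] B. B. Gordon, *A survey of the Hodge conjecture for abelian varieties*, Prop. 9.4.1.
* [Carlet2020] C. Carlet, *Boolean Functions for Cryptography and Coding Theory*, CUP (2020), §2.3 (Walsh
  transform), §3.1 (3.10) (fourth moment).
* [Kida2019CountingCMTypes] M. Kida, *Counting formulas for CM-types*, Lemma 2.3 (`2^{|G|/2}` half-systems).

## Provenance

Lane `lit-hodgefound` (Track 2, Layer A3), seat `lit-hodgefound-p10` generation 41, row g41-#2; neighbours cited
by name, nothing restated: `DegenerateCMTypesAbelianSwaps` (`AbelianSwap.isCMTypeWith_sdiff_union_image`,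
`AbelianSwap.sdiff_union_image_sdiff_eq`, `ExponentTwo.isCMTypeWith_filter_eq_one`, `two_mul_card_filter_eq_one`),
`DegenerateCMTypesElementaryAbelianTwoGroup` (`card_filter_mod_two_eq`, `typeRank_eq_of_odd`,
`typeRank_eq_two_or_five_of_even`, `two_mul_card`), `DegenerateCMTypesElementaryAbelianOrderThirtyTwo`
(`typeRank_mem_of_card_thirtytwo`), `CMTypeElementaryTwoGroupOddWeights` (`character_apply_eq_one_or_of_mul_self`),
Mathlib `Finset.sum_powerset_apply_card`, `Finset.sum_powerset_neg_one_pow_card_of_nonempty`.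
-/

open scoped BigOperators Classical

namespace Literature.NumberTheory.ComplexMultiplication

namespace CyclicCMType

namespace ExponentTwo

namespace SignCount

variable {G : Type*} [CommGroup G] [Fintype G] [DecidableEq G] {ρ : G} {T : Finset G}
  {χ : AddChar (Additive G) ℂ}

/-! ## §0 Helpers -/

section Helpers

omit [Fintype G] [DecidableEq G] in
/-- `g·g = 1` in exponent `2`. [folklore] -/
private theorem mul_self_eq_one_sc (hexp : ∀ g : G, g ^ 2 = 1) (g : G) : g * g = 1 := by
  rw [← pow_two]; exact hexp g

omit [Fintype G] [DecidableEq G] in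
/-- Characters of a group of exponent `2` are `±1`-valued. [folklore] -/
private theorem char_eq_one_or_sc (hexp : ∀ g : G, g ^ 2 = 1) (χ : AddChar (Additive G) ℂ) (g : G) :
    χ (Additive.ofMul g) = 1 ∨ χ (Additive.ofMul g) = -1 :=
  character_apply_eq_one_or_of_mul_self χ (mul_self_eq_one_sc hexp g)

omit [Fintype G] [DecidableEq G] in
/-- `χ(gh) = χ(g)χ(h)`. [folklore] -/
private theorem char_mul_sc (χ : AddChar (Additive G) ℂ) (g h : G) :
    χ (Additive.ofMul (g * h)) = χ (Additive.ofMul g) * χ (Additive.ofMul h) := by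
  rw [ofMul_mul, AddChar.map_add_eq_mul]

omit [Fintype G] [DecidableEq G] in
/-- An odd character is non-trivial. [folklore] -/
private theorem ne_zero_of_odd_sc (hχ : χ (Additive.ofMul ρ) = -1) : χ ≠ 0 := by
  intro h0
  rw [h0, AddChar.zero_apply] at hχ
  norm_num at hχ

omit [Fintype G] [DecidableEq G] in
/-- `χ(g) ≠ 1 ⟺ χ(g) = −1` in exponent `2`. [folklore] -/
private theorem char_ne_one_iff_sc (hexp : ∀ g : G, g ^ 2 = 1) (χ : AddChar (Additive G) ℂ) (g : G) :
    χ (Additive.ofMul g) ≠ 1 ↔ χ (Additive.ofMul g) = -1 := by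
  rcases char_eq_one_or_sc hexp χ g with e | e <;> rw [e] <;> norm_num

omit [DecidableEq G] in
/-- `2|T| = |G|` for a CM type. [folklore] -/
private theorem two_mul_card_sc (h : IsCMTypeWith ρ (T : Set G)) : 2 * T.card = Fintype.card G := by
  have hρ2 : ρ * ρ = 1 := by
    have := h.invol (1 : G)
    simpa [smul_eq_mul] using this
  have hmem : ∀ x : G, ρ * x ∈ T ↔ x ∉ T := fun x => by
    have := h.rho_smul_mem_iff x
    simpa only [smul_eq_mul, Finset.mem_coe] using this
  have hinj : Function.Injective fun s : G => ρ * s := fun a b hab => mul_left_cancel hab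
  have hc : Tᶜ = T.image fun s => ρ * s := by
    ext x
    rw [Finset.mem_compl, Finset.mem_image]
    constructor
    · intro hx
      refine ⟨ρ * x, (hmem x).2 hx, ?_⟩
      show ρ * (ρ * x) = x
      rw [← mul_assoc, hρ2, one_mul]
    · rintro ⟨s, hs, rfl⟩
      exact fun hx => ((hmem s).1 hx) hs
  have h1 : Tᶜ.card = T.card := by rw [hc, Finset.card_image_of_injective _ hinj]
  have h2 := Finset.card_add_card_compl T
  omega

omit [DecidableEq G] in
/-- `|T| = |R_χ|` for a CM type `T` and the kernel type `R_χ` (both are `|G|/2`). [folklore] -/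
private theorem card_eq_card_kernel_sc (hexp : ∀ g : G, g ^ 2 = 1) (h : IsCMTypeWith ρ (T : Set G))
    (hχ : χ (Additive.ofMul ρ) = -1) :
    T.card = (Finset.univ.filter fun g : G => χ (Additive.ofMul g) = 1).card := by
  have h1 := two_mul_card_sc h
  have h2 := two_mul_card_filter_eq_one hexp (ne_zero_of_odd_sc hχ)
  omega

end Helpers

/-! ## §1 The swap parametrisation `T = R_χ^D`, `D = R_χ ∖ T`, `a_χ(T) = |D|` -/

section Parametrisation

omit [Fintype G] in
/-- **The swap datum is recovered: `R ∖ R^D = D`** for `D ⊆ R ⊆ {χ = 1}` and `χ` odd (`ρD` lies in `{χ = −1}`,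
outside `R`). [cite: Dodson1984, §3.1.1 Theorem] -/
theorem sdiff_sdiff_union_image_eq (hχ : χ (Additive.ofMul ρ) = -1) {R D : Finset G}
    (hR : ∀ r ∈ R, χ (Additive.ofMul r) = 1) (hD : D ⊆ R) :
    R \ ((R \ D) ∪ D.image (fun d => ρ * d)) = D := by
  ext d
  simp only [Finset.mem_sdiff, Finset.mem_union, Finset.mem_image, not_or, not_exists, not_and]
  constructor
  · rintro ⟨hdR, h1, -⟩
    by_contra hdD
    exact h1 hdR hdD
  · intro hdD
    refine ⟨hD hdD, fun _ => by simpa using hdD, fun d' hd' hEq => ?_⟩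
    have h1 : χ (Additive.ofMul (ρ * d')) = -1 := by rw [char_mul_sc, hχ, hR d' (hD hd')]; norm_num
    rw [hEq, hR d (hD hdD)] at h1
    norm_num at h1

/-- **Every CM type is a swap of the kernel type: `R_χ^{R_χ ∖ T} = T`** (tree `AbelianSwap.sdiff_union_image_sdiff_eq`
with the kernel type `R_χ`, a CM type by the tree's `isCMTypeWith_filter_eq_one`). [cite: Dodson1984, §3.1.1 Theorem]
[cite: Kubota1965, §2] -/
theorem sdiff_union_image_kernel_sdiff_eq (hexp : ∀ g : G, g ^ 2 = 1) (h : IsCMTypeWith ρ (T : Set G))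
    (hχ : χ (Additive.ofMul ρ) = -1) :
    ((Finset.univ.filter fun g : G => χ (Additive.ofMul g) = 1) \
        ((Finset.univ.filter fun g : G => χ (Additive.ofMul g) = 1) \ T)) ∪
      ((Finset.univ.filter fun g : G => χ (Additive.ofMul g) = 1) \ T).image (fun d => ρ * d) = T :=
  AbelianSwap.sdiff_union_image_sdiff_eq
    (isCMTypeWith_filter_eq_one hexp (mul_self_eq_one_sc hexp ρ) hχ) h

/-- **`a_χ(T) = |R_χ ∖ T|`**: the sign count of a CM type along an odd `χ` is the number of kernel elements it
omits (`t ↦ ρt` exchanges `{t ∈ T : χ(t) = −1}` and `R_χ ∖ T`; here by counting: `|T| = |R_χ|` and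
`T ∩ R_χ = {t ∈ T : χ(t) = 1}`). [cite: Dodson1984, §3.1.1 Theorem] [cite: Kubota1965, §4 Lemma 2] -/
theorem card_filter_eq_card_kernel_sdiff (hexp : ∀ g : G, g ^ 2 = 1) (h : IsCMTypeWith ρ (T : Set G))
    (hχ : χ (Additive.ofMul ρ) = -1) :
    (T.filter fun s => χ (Additive.ofMul s) = -1).card =
      ((Finset.univ.filter fun g : G => χ (Additive.ofMul g) = 1) \ T).card := by
  have hTR : (T.filter fun s => χ (Additive.ofMul s) = -1) =
      T \ (Finset.univ.filter fun g : G => χ (Additive.ofMul g) = 1) := by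
    ext t
    simp only [Finset.mem_filter, Finset.mem_sdiff, Finset.mem_univ, true_and]
    rw [← char_ne_one_iff_sc hexp χ t]
  have h1 := Finset.card_sdiff_add_card_inter T (Finset.univ.filter fun g : G => χ (Additive.ofMul g) = 1)
  have h2 := Finset.card_sdiff_add_card_inter (Finset.univ.filter fun g : G => χ (Additive.ofMul g) = 1) T
  rw [Finset.inter_comm] at h2
  have h3 := card_eq_card_kernel_sc hexp h hχ
  rw [hTR]
  omega

/-- **THE SWAP PARAMETRISATION**: for an odd character `χ` with kernel type `R_χ = {χ = 1}`, `T ↦ R_χ ∖ T` is a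
bijection from the CM types (w.r.t. `ρ`) onto the subsets of `R_χ` (inverse `D ↦ R_χ^D = (R_χ ∖ D) ∪ ρD`) carrying
`a_χ(T)` to `|D|`; hence `Σ_{T CM type} f(a_χ(T)) = Σ_{D ⊆ R_χ} f(|D|)` for every `f` (Dodson: the types of a field of
type `(2, …, 2)` over a fixed imaginary quadratic subfield are the vectors `f ∈ (ℤ₂)ⁿ`). [cite: Dodson1984, §3.1.1 Theorem]
[cite: Kubota1965, §2] -/
theorem sum_eq_sum_powerset {M : Type*} [AddCommMonoid M] (hexp : ∀ g : G, g ^ 2 = 1) (hρ2 : ρ * ρ = 1)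
    (hχ : χ (Additive.ofMul ρ) = -1) (f : ℕ → M) :
    ∑ T ∈ (Finset.univ : Finset (Finset G)).filter (fun T : Finset G => IsCMTypeWith ρ (T : Set G)),
        f (T.filter fun s => χ (Additive.ofMul s) = -1).card =
      ∑ D ∈ (Finset.univ.filter fun g : G => χ (Additive.ofMul g) = 1).powerset, f D.card := by
  set R := Finset.univ.filter fun g : G => χ (Additive.ofMul g) = 1 with hR
  have hRtype : IsCMTypeWith ρ (R : Set G) := isCMTypeWith_filter_eq_one hexp hρ2 hχ
  have hRχ : ∀ r ∈ R, χ (Additive.ofMul r) = 1 := fun r hr => (Finset.mem_filter.1 hr).2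
  refine Finset.sum_nbij' (fun T => R \ T) (fun D => (R \ D) ∪ D.image (fun d => ρ * d)) ?_ ?_ ?_ ?_ ?_
  · intro T _
    exact Finset.mem_powerset.2 Finset.sdiff_subset
  · intro D hD
    simp only [Finset.mem_filter, Finset.mem_univ, true_and]
    exact AbelianSwap.isCMTypeWith_sdiff_union_image hRtype (Finset.mem_powerset.1 hD)
  · intro T hT
    exact AbelianSwap.sdiff_union_image_sdiff_eq hRtype (Finset.mem_filter.1 hT).2
  · intro D hD
    exact sdiff_sdiff_union_image_eq hχ hRχ (Finset.mem_powerset.1 hD)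
  · intro T hT
    rw [card_filter_eq_card_kernel_sdiff hexp (Finset.mem_filter.1 hT).2 hχ]

/-- **`Σ_{T CM type} f(a_χ(T)) = Σ_{j=0}^{m} C(m, j)·f(j)`, `m = |R_χ| = |G|/2`** (the subsets of `R_χ` by size,
Mathlib `Finset.sum_powerset_apply_card`). [cite: Dodson1984, §3.1.1 Theorem] [cite: Kubota1965, §2] -/
theorem sum_eq_sum_range_choose {M : Type*} [AddCommMonoid M] (hexp : ∀ g : G, g ^ 2 = 1) (hρ2 : ρ * ρ = 1)
    (hχ : χ (Additive.ofMul ρ) = -1) (f : ℕ → M) :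
    ∑ T ∈ (Finset.univ : Finset (Finset G)).filter (fun T : Finset G => IsCMTypeWith ρ (T : Set G)),
        f (T.filter fun s => χ (Additive.ofMul s) = -1).card =
      ∑ j ∈ Finset.range (Fintype.card G / 2 + 1), (Fintype.card G / 2).choose j • f j := by
  have hm : (Finset.univ.filter fun g : G => χ (Additive.ofMul g) = 1).card = Fintype.card G / 2 := by
    have := two_mul_card_filter_eq_one hexp (ne_zero_of_odd_sc hχ); omega
  rw [sum_eq_sum_powerset hexp hρ2 hχ f, Finset.sum_powerset_apply_card, hm]

end Parametrisation

/-! ## §2 Counts: `C(|G|/2, j)` types with `a_χ = j`; `2^{|G|/2 − 1}` even and `2^{|G|/2 − 1}` odd types -/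

section Counts

/-- **`#{T CM type : a_χ(T) = j} = C(|G|/2, j)`** for every odd `χ` and every `j`. [cite: Dodson1984, §3.1.1 Theorem]
[cite: Kida2019CountingCMTypes, Lemma 2.3] -/
theorem card_filter_signCount_eq (hexp : ∀ g : G, g ^ 2 = 1) (hρ2 : ρ * ρ = 1)
    (hχ : χ (Additive.ofMul ρ) = -1) (j : ℕ) :
    ((Finset.univ : Finset (Finset G)).filter fun T : Finset G =>
      IsCMTypeWith ρ (T : Set G) ∧ (T.filter fun s => χ (Additive.ofMul s) = -1).card = j).card =
      (Fintype.card G / 2).choose j := by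
  have key := sum_eq_sum_range_choose hexp hρ2 hχ (fun a => if a = j then (1 : ℕ) else 0)
  rw [← Finset.sum_filter, Finset.filter_filter, Finset.sum_const, smul_eq_mul, mul_one] at key
  rw [key]
  simp_rw [smul_eq_mul, mul_ite, mul_one, mul_zero]
  rw [Finset.sum_ite_eq']
  split_ifs with hj
  · rfl
  · rw [Finset.mem_range, not_lt] at hj
    exact (Nat.choose_eq_zero_of_lt (by omega)).symm

omit [CommGroup G] [Fintype G] [DecidableEq G] in
/-- **Half the subsets of a non-empty finite set have even size**: `2·#{D ⊆ R : |D| even} = 2^{|R|}` (from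
`Σ_{D ⊆ R} (−1)^{|D|} = 0`, Mathlib `Finset.sum_powerset_neg_one_pow_card_of_nonempty`). [folklore] -/
private theorem two_mul_card_powerset_filter_even {R : Finset G} (hR : R.Nonempty) :
    2 * (R.powerset.filter fun D : Finset G => Even D.card).card = 2 ^ R.card := by
  have halt := Finset.sum_powerset_neg_one_pow_card_of_nonempty hR
  have htot := Finset.card_powerset R
  have hsplit := Finset.card_filter_add_card_filter_not (s := R.powerset) (fun D : Finset G => Even D.card)
  -- `Σ (−1)^{|D|} = #even − #odd`
  have hpt : ∀ D ∈ R.powerset, (-1 : ℤ) ^ D.card =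
      (if Even D.card then 1 else 0) - (if ¬ Even D.card then 1 else 0) := by
    intro D _
    by_cases he : Even D.card
    · rw [if_pos he, if_neg (not_not.2 he), he.neg_one_pow]; norm_num
    · rw [if_neg he, if_pos he, (Nat.not_even_iff_odd.1 he).neg_one_pow]; norm_num
  rw [Finset.sum_congr rfl hpt, Finset.sum_sub_distrib, Finset.sum_boole, Finset.sum_boole] at halt
  rw [htot] at hsplit
  omega

/-- **`#{T CM type : a_χ(T) EVEN} = 2^{|G|/2 − 1}`** (`ρ ≠ 1`, `χ` odd): half of the `2^{|G|/2}` CM types.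
[cite: Dodson1984, §3.1.1 Theorem] [cite: Kida2019CountingCMTypes, Lemma 2.3] -/
theorem card_filter_even_signCount (hexp : ∀ g : G, g ^ 2 = 1) (hχ : χ (Additive.ofMul ρ) = -1) :
    ((Finset.univ : Finset (Finset G)).filter fun T : Finset G =>
      IsCMTypeWith ρ (T : Set G) ∧ Even (T.filter fun s => χ (Additive.ofMul s) = -1).card).card =
      2 ^ (Fintype.card G / 2 - 1) := by
  have hρ2 : ρ * ρ = 1 := mul_self_eq_one_sc hexp ρ
  have hm : (Finset.univ.filter fun g : G => χ (Additive.ofMul g) = 1).card = Fintype.card G / 2 := by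
    have := two_mul_card_filter_eq_one hexp (ne_zero_of_odd_sc hχ); omega
  have hRne : (Finset.univ.filter fun g : G => χ (Additive.ofMul g) = 1).Nonempty := ⟨1, by
    rw [Finset.mem_filter]; exact ⟨Finset.mem_univ _, by rw [ofMul_one, AddChar.map_zero_eq_one]⟩⟩
  have key := sum_eq_sum_powerset hexp hρ2 hχ (fun a => if Even a then (1 : ℕ) else 0)
  rw [← Finset.sum_filter, Finset.filter_filter, Finset.sum_const, smul_eq_mul, mul_one, ← Finset.sum_filter,
    Finset.sum_const, smul_eq_mul, mul_one] at key
  rw [key]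
  have h2 := two_mul_card_powerset_filter_even hRne
  rw [hm] at h2
  have hpos : 1 ≤ Fintype.card G / 2 := by rw [← hm]; exact Finset.card_pos.2 hRne
  have hpow : 2 ^ (Fintype.card G / 2) = 2 * 2 ^ (Fintype.card G / 2 - 1) := by
    rw [← pow_succ']; congr 1; omega
  omega

/-- **`#{T CM type : a_χ(T) ODD} = 2^{|G|/2 − 1}`** (`ρ ≠ 1`, `χ` odd): the other half. [cite: Dodson1984, §3.1.1 Theorem]
[cite: Kida2019CountingCMTypes, Lemma 2.3] -/
theorem card_filter_odd_signCount (hexp : ∀ g : G, g ^ 2 = 1) (hχ : χ (Additive.ofMul ρ) = -1) :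
    ((Finset.univ : Finset (Finset G)).filter fun T : Finset G =>
      IsCMTypeWith ρ (T : Set G) ∧ Odd (T.filter fun s => χ (Additive.ofMul s) = -1).card).card =
      2 ^ (Fintype.card G / 2 - 1) := by
  have hρ2 : ρ * ρ = 1 := mul_self_eq_one_sc hexp ρ
  have hm : (Finset.univ.filter fun g : G => χ (Additive.ofMul g) = 1).card = Fintype.card G / 2 := by
    have := two_mul_card_filter_eq_one hexp (ne_zero_of_odd_sc hχ); omega
  have hRne : (Finset.univ.filter fun g : G => χ (Additive.ofMul g) = 1).Nonempty := ⟨1, by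
    rw [Finset.mem_filter]; exact ⟨Finset.mem_univ _, by rw [ofMul_one, AddChar.map_zero_eq_one]⟩⟩
  have key := sum_eq_sum_powerset hexp hρ2 hχ (fun a => if ¬ Even a then (1 : ℕ) else 0)
  rw [← Finset.sum_filter, Finset.filter_filter, Finset.sum_const, smul_eq_mul, mul_one, ← Finset.sum_filter,
    Finset.sum_const, smul_eq_mul, mul_one] at key
  have hodd : ((Finset.univ : Finset (Finset G)).filter fun T : Finset G =>
      IsCMTypeWith ρ (T : Set G) ∧ Odd (T.filter fun s => χ (Additive.ofMul s) = -1).card) =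
      (Finset.univ : Finset (Finset G)).filter fun T : Finset G =>
        IsCMTypeWith ρ (T : Set G) ∧ ¬ Even (T.filter fun s => χ (Additive.ofMul s) = -1).card :=
    Finset.filter_congr fun T _ => by rw [Nat.not_even_iff_odd]
  rw [hodd, key]
  have h2 := two_mul_card_powerset_filter_even hRne
  have hsplit := Finset.card_filter_add_card_filter_not
    (s := (Finset.univ.filter fun g : G => χ (Additive.ofMul g) = 1).powerset) (fun D : Finset G => Even D.card)
  rw [Finset.card_powerset, hm] at hsplit
  rw [hm] at h2
  have hpos : 1 ≤ Fintype.card G / 2 := by rw [← hm]; exact Finset.card_pos.2 hRne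
  have hpow : 2 ^ (Fintype.card G / 2) = 2 * 2 ^ (Fintype.card G / 2 - 1) := by
    rw [← pow_succ']; congr 1; omega
  omega

/-- **AT LEAST HALF OF THE CM TYPES ARE NONDEGENERATE** (`8 ∣ |G|`): the `2^{|G|/2 − 1}` odd types have full
Kubota rank `|G|/2 + 1` (tree `typeRank_eq_of_odd`) — a multiquadratic CM field of degree `2g ≥ 8` has at least
`2^{g−1}` nondegenerate CM types. [cite: Kubota1965, §4 Lemma 2] [cite: Dodson1984, §3.1.1 Theorem] -/
theorem two_pow_le_card_filter_typeRank_eq (hexp : ∀ g : G, g ^ 2 = 1) (hρ1 : ρ ≠ 1) (h8 : 8 ∣ Fintype.card G) :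
    2 ^ (Fintype.card G / 2 - 1) ≤ ((Finset.univ : Finset (Finset G)).filter fun T : Finset G =>
      IsCMTypeWith ρ (T : Set G) ∧ typeRank G (T : Set G) = Fintype.card G / 2 + 1).card := by
  have hρ2 : ρ * ρ = 1 := mul_self_eq_one_sc hexp ρ
  -- an odd character exists
  have hρ0 : (Additive.ofMul ρ : Additive G) ≠ 0 := fun h0 => hρ1 (by simpa using congrArg Additive.toMul h0)
  obtain ⟨χ₀, hχ₀'⟩ := (AddChar.exists_apply_ne_zero (α := Additive G)).2 hρ0
  have hχ₀ : χ₀ (Additive.ofMul ρ) = -1 := (character_apply_eq_one_or_of_mul_self χ₀ hρ2).resolve_left hχ₀'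
  rw [← card_filter_odd_signCount hexp hχ₀]
  refine Finset.card_le_card fun T hT => ?_
  simp only [Finset.mem_filter, Finset.mem_univ, true_and] at hT ⊢
  exact ⟨hT.1, typeRank_eq_of_odd hexp hT.1 h8 hχ₀ hT.2⟩

/-- **ORDER `16`: NONDEGENERATE ⟺ ODD** — on `(ℤ/2)⁴` a CM type has rank `9` iff its sign counts are odd (even types
have rank `2` or `5`, tree `typeRank_eq_two_or_five_of_even`; odd types rank `9`, tree `typeRank_eq_of_odd`).
[cite: Kubota1965, §4 Lemma 2] [cite: Dodson1984, §3.1.1 Theorem] -/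
theorem typeRank_eq_nine_iff_odd_of_card_sixteen (hexp : ∀ g : G, g ^ 2 = 1) (h : IsCMTypeWith ρ (T : Set G))
    (h16 : Fintype.card G = 16) (hχ : χ (Additive.ofMul ρ) = -1) :
    typeRank G (T : Set G) = 9 ↔ Odd (T.filter fun s => χ (Additive.ofMul s) = -1).card := by
  constructor
  · intro h9
    by_contra hodd
    rw [Nat.not_odd_iff_even] at hodd
    rcases typeRank_eq_two_or_five_of_even hexp h h16 hχ hodd with h2 | h5 <;> omega
  · intro hodd
    rw [typeRank_eq_of_odd hexp h (by rw [h16]; norm_num) hχ hodd, h16]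

/-- **ORDER `16`: the `128` odd types are exactly the nondegenerate ones** (`#{T : a_χ(T) odd} = 2⁷ = 128`; the rank-`9`
census `128` of the sibling `MultiquadraticCMFieldRankNineCensus` recovered through the parity class).
[cite: Kubota1965, §4 Lemma 2] [cite: Dodson1984, §3.1.1 Theorem] -/
theorem card_filter_odd_signCount_of_card_eq_sixteen (hexp : ∀ g : G, g ^ 2 = 1)
    (h16 : Fintype.card G = 16) (hχ : χ (Additive.ofMul ρ) = -1) :
    ((Finset.univ : Finset (Finset G)).filter fun T : Finset G =>
      IsCMTypeWith ρ (T : Set G) ∧ Odd (T.filter fun s => χ (Additive.ofMul s) = -1).card).card = 128 ∧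
    ((Finset.univ : Finset (Finset G)).filter fun T : Finset G =>
      IsCMTypeWith ρ (T : Set G) ∧ Odd (T.filter fun s => χ (Additive.ofMul s) = -1).card) =
      (Finset.univ : Finset (Finset G)).filter fun T : Finset G =>
        IsCMTypeWith ρ (T : Set G) ∧ typeRank G (T : Set G) = 9 := by
  refine ⟨by rw [card_filter_odd_signCount hexp hχ, h16]; norm_num, ?_⟩
  exact Finset.filter_congr fun T _ => and_congr_right fun hT =>
    (typeRank_eq_nine_iff_odd_of_card_sixteen hexp hT h16 hχ).symm

/-- **ORDER `32`: `32768` ODD AND `32768` EVEN CM TYPES** (w.r.t. any odd `χ`; `2¹⁵` each).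
[cite: Dodson1984, §3.1.1 Theorem] [cite: Kida2019CountingCMTypes, Lemma 2.3] -/
theorem card_filter_odd_signCount_of_card_eq_thirtyTwo (hexp : ∀ g : G, g ^ 2 = 1)
    (h32 : Fintype.card G = 32) (hχ : χ (Additive.ofMul ρ) = -1) :
    ((Finset.univ : Finset (Finset G)).filter fun T : Finset G =>
      IsCMTypeWith ρ (T : Set G) ∧ Odd (T.filter fun s => χ (Additive.ofMul s) = -1).card).card = 32768 ∧
    ((Finset.univ : Finset (Finset G)).filter fun T : Finset G =>
      IsCMTypeWith ρ (T : Set G) ∧ Even (T.filter fun s => χ (Additive.ofMul s) = -1).card).card = 32768 := by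
  refine ⟨by rw [card_filter_odd_signCount hexp hχ, h32]; norm_num,
    by rw [card_filter_even_signCount hexp hχ, h32]; norm_num⟩

/-- **ORDER `32`: THE `32768` ODD TYPES ALL HAVE RANK `17`**, so at least `32768` of the `65536` CM types are
nondegenerate; the types of rank `2, 5, 9, 11` are all even. [cite: Kubota1965, §4 Lemma 2] [cite: Dodson1984, §3.1.1 Theorem] -/
theorem filter_odd_subset_filter_typeRank_eq_of_card_eq_thirtyTwo (hexp : ∀ g : G, g ^ 2 = 1)
    (h32 : Fintype.card G = 32) (hχ : χ (Additive.ofMul ρ) = -1) :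
    ((Finset.univ : Finset (Finset G)).filter fun T : Finset G =>
      IsCMTypeWith ρ (T : Set G) ∧ Odd (T.filter fun s => χ (Additive.ofMul s) = -1).card) ⊆
    ((Finset.univ : Finset (Finset G)).filter fun T : Finset G =>
      IsCMTypeWith ρ (T : Set G) ∧ typeRank G (T : Set G) = 17) := by
  intro T hT
  simp only [Finset.mem_filter, Finset.mem_univ, true_and] at hT ⊢
  refine ⟨hT.1, ?_⟩
  rw [typeRank_eq_of_odd hexp hT.1 (by rw [h32]; norm_num) hχ hT.2, h32]

/-- **ORDER `32`: an EVEN type has rank `2, 5, 9` or `11`, or rank `17`** (the even types of rank `17` are the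
"bent" ones, all `|Ŝ(χ)| = 4`; counted in the sequel), and **a type of rank `≠ 17` is even**.
[cite: Kubota1965, §4 Lemma 2] [cite: Dodson1984, §3.1.1 Theorem] -/
theorem even_of_typeRank_ne_of_card_eq_thirtyTwo (hexp : ∀ g : G, g ^ 2 = 1) (h : IsCMTypeWith ρ (T : Set G))
    (h32 : Fintype.card G = 32) (hχ : χ (Additive.ofMul ρ) = -1) (hne : typeRank G (T : Set G) ≠ 17) :
    Even (T.filter fun s => χ (Additive.ofMul s) = -1).card := by
  by_contra hodd
  rw [Nat.not_even_iff_odd] at hodd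
  exact hne (by rw [typeRank_eq_of_odd hexp h (by rw [h32]; norm_num) hχ hodd, h32])

end Counts

/-! ## §3 Moments of the character sums -/

section Moments

/-- **MOMENTS OF THE CHARACTER SUMS OVER ALL CM TYPES**: for an odd `χ`, `m = |G|/2` and every `k`,
`Σ_{T CM type} (m − 2a_χ(T))^k = Σ_{j=0}^{m} C(m, j)·(m − 2j)^k` — `m − 2a_χ(T) = Ŝ_T(χ) = Σ_{t∈T} χ(t)` (tree
`sum_char_eq_card_sub_two_mul`), and over a uniformly random CM type `Ŝ_T(χ)` is a sum of `m` independent signs.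
[cite: Dodson1984, §3.1.1 Theorem] [cite: Carlet2020, §3.1 (3.10)] -/
theorem sum_pow_signCount_eq (hexp : ∀ g : G, g ^ 2 = 1) (hρ2 : ρ * ρ = 1) (hχ : χ (Additive.ofMul ρ) = -1)
    (k : ℕ) :
    ∑ T ∈ (Finset.univ : Finset (Finset G)).filter (fun T : Finset G => IsCMTypeWith ρ (T : Set G)),
        ((Fintype.card G / 2 : ℕ) - 2 * ((T.filter fun s => χ (Additive.ofMul s) = -1).card : ℤ)) ^ k =
      ∑ j ∈ Finset.range (Fintype.card G / 2 + 1),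
        (Fintype.card G / 2).choose j • (((Fintype.card G / 2 : ℕ) : ℤ) - 2 * j) ^ k :=
  sum_eq_sum_range_choose hexp hρ2 hχ (fun a => (((Fintype.card G / 2 : ℕ) : ℤ) - 2 * a) ^ k)

/-- **Moments over the EVEN types**: `Σ_{T : a_χ(T) even} F(a_χ(T)) = Σ_{j even} C(m, j)·F(j)` for every `F`.
[cite: Dodson1984, §3.1.1 Theorem] -/
theorem sum_filter_even_eq {M : Type*} [AddCommMonoid M] (hexp : ∀ g : G, g ^ 2 = 1) (hρ2 : ρ * ρ = 1)
    (hχ : χ (Additive.ofMul ρ) = -1) (F : ℕ → M) :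
    ∑ T ∈ (Finset.univ : Finset (Finset G)).filter (fun T : Finset G =>
        IsCMTypeWith ρ (T : Set G) ∧ Even (T.filter fun s => χ (Additive.ofMul s) = -1).card),
        F (T.filter fun s => χ (Additive.ofMul s) = -1).card =
      ∑ j ∈ Finset.range (Fintype.card G / 2 + 1),
        (Fintype.card G / 2).choose j • (if Even j then F j else 0) := by
  rw [← sum_eq_sum_range_choose hexp hρ2 hχ (fun a => if Even a then F a else 0), ← Finset.filter_filter,
    Finset.sum_filter]

/-- **ORDER `16`, fourth moment over the even types**: `Σ_{T even} (4 − a_χ(T))⁴ = 1408` for every odd `χ`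
(`= 256 + 28·16 + 0 + 28·16 + 256`). [cite: Dodson1984, §3.1.1 Theorem] [cite: Carlet2020, §3.1 (3.10)] -/
theorem sum_filter_even_fourth_of_card_eq_sixteen (hexp : ∀ g : G, g ^ 2 = 1) (hρ2 : ρ * ρ = 1)
    (hχ : χ (Additive.ofMul ρ) = -1) (h16 : Fintype.card G = 16) :
    ∑ T ∈ (Finset.univ : Finset (Finset G)).filter (fun T : Finset G =>
        IsCMTypeWith ρ (T : Set G) ∧ Even (T.filter fun s => χ (Additive.ofMul s) = -1).card),
        ((4 : ℤ) - ((T.filter fun s => χ (Additive.ofMul s) = -1).card : ℤ)) ^ 4 = 1408 := by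
  rw [sum_filter_even_eq hexp hρ2 hχ (fun a => ((4 : ℤ) - (a : ℤ)) ^ 4), h16]
  decide

/-- **ORDER `32`, FOURTH MOMENT OVER THE EVEN TYPES: `Σ_{T even} (8 − a_χ(T))⁴ = 1507328`** for every odd `χ`
(`= 2·(1·4096 + 120·1296 + 1820·256 + 8008·16)`; i.e. `Σ_{T even} Ŝ_T(χ)⁴ = 16·1507328`) — the input of the
fourth-moment count of the types of rank `11` and `17` in the sequel. [cite: Dodson1984, §3.1.1 Theorem]
[cite: Carlet2020, §3.1 (3.10)] -/
theorem sum_filter_even_fourth_of_card_eq_thirtyTwo (hexp : ∀ g : G, g ^ 2 = 1) (hρ2 : ρ * ρ = 1)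
    (hχ : χ (Additive.ofMul ρ) = -1) (h32 : Fintype.card G = 32) :
    ∑ T ∈ (Finset.univ : Finset (Finset G)).filter (fun T : Finset G =>
        IsCMTypeWith ρ (T : Set G) ∧ Even (T.filter fun s => χ (Additive.ofMul s) = -1).card),
        ((8 : ℤ) - ((T.filter fun s => χ (Additive.ofMul s) = -1).card : ℤ)) ^ 4 = 1507328 := by
  rw [sum_filter_even_eq hexp hρ2 hχ (fun a => ((8 : ℤ) - (a : ℤ)) ^ 4), h32]
  decide

/-- **ORDER `32`, fourth moment over ALL types**: `Σ_T (8 − a_χ(T))⁴ = 3014656 = 2¹⁶·46` (`46 = (3·16² − 2·16)/16`: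
the fourth moment of a sum of `16` signs); the odd types contribute the same `1507328` as the even ones.
[cite: Dodson1984, §3.1.1 Theorem] [cite: Carlet2020, §3.1 (3.10)] -/
theorem sum_fourth_of_card_eq_thirtyTwo (hexp : ∀ g : G, g ^ 2 = 1) (hρ2 : ρ * ρ = 1)
    (hχ : χ (Additive.ofMul ρ) = -1) (h32 : Fintype.card G = 32) :
    ∑ T ∈ (Finset.univ : Finset (Finset G)).filter (fun T : Finset G => IsCMTypeWith ρ (T : Set G)),
        ((8 : ℤ) - ((T.filter fun s => χ (Additive.ofMul s) = -1).card : ℤ)) ^ 4 = 3014656 := by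
  rw [sum_eq_sum_range_choose hexp hρ2 hχ (fun a => ((8 : ℤ) - (a : ℤ)) ^ 4), h32]
  decide

end Moments

end SignCount

end ExponentTwo

end CyclicCMType

end Literature.NumberTheory.ComplexMultiplication
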